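import Mathlib.Data.List.Basic
import HarnessLib

/-!
# Coordinate-bound facts for fibre leaf files from ONE Boolean computation (CDX, qec-cdx-eng-1)

`cnfEncodeAny_unsat_imp` needs `∀ r ∈ rows, ∀ i ∈ r, i < n` and `∀ u ∈ us, ∀ i ∈ u, i < n`; deciding these through the nested
`Decidable` instances builds large terms for big row lists. These two lemmas obtain them from `List.all` Booleans, which
`decide +kernel` evaluates cheaply.
-/

namespace Summit.Ventures.QEC.CircuitDistance

/-- Nested coordinate bound from a Boolean `all`/`all` computation. -/
theorem forall_mem_lt_of_all (rows : List (List ℕ)) (n : ℕ)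
    (h : (rows.all fun r => r.all fun i => decide (i < n)) = true) : ∀ r ∈ rows, ∀ i ∈ r, i < n := by
  intro r hr i hi
  have := List.all_eq_true.1 (List.all_eq_true.1 h r hr) i hi
  simpa using this

end Summit.Ventures.QEC.CircuitDistance
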